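import Mathlib.MeasureTheory.Integral.IntervalIntegral.FundThmCalculus
import Mathlib.Analysis.Calculus.Deriv.MeanValue
import Mathlib.Analysis.SpecialFunctions.Trigonometric.DerivHyp
import Mathlib.Analysis.SpecialFunctions.Sqrt
import Summits.HubbardSuperconductivity.HubbardSuperconductivity.Theorems.ThermalWedgeTwSeededEnsembleEquivalenceRFreePressureLimit

/-!
# Crux `TwSeededEnsembleEquivalenceR` (stmt-HubbardSuperconductivity-15581), line `cold-floor-collapse`
# (slug `Sketch`) — S4b `stub_freeColdEdgeIncrements` reduced to two Brillouin-zone density bounds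

Support file (`--supports stmt-HubbardSuperconductivity-15581`; sorry-free; no definition). The free-gas stub
`stub_freeColdEdgeIncrements` (two cold edge increments of the limit pressure `q₀` of the `U = 0`
`d`-wave-sourced BdG torus, `β ≥ 20`, `|h| ≤ 3`) is reduced to two explicit, `β,h`-uniform bounds on the
zone average `N(β,μ,h) = (1/4π²)∫₀^{2π}∫₀^{2π} [1 − (ξ/E) tanh(βE/2)] dθ₂ dθ₁`, `ξ = −2(cos θ₁ + cos θ₂) − μ`,
`E² = ξ² + 8h²(cos θ₁ − cos θ₂)²`, of the free BdG density:

* registered helper stub `cfl_freeColdEdgeIncrements_of_densityBounds`: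
  `[∀ β ≥ 20, |h| ≤ 3: N(β,−193/50,h) ≤ 237/400] → [∀ β ≥ 20, |h| ≤ 3: N(β,−9/100,h) ≥ 4557/5000] →
   stub_freeColdEdgeIncrements` (the two hypotheses are the registered residue stubs
   `stub_freeColdDensityBound_m/_p`; numerically `sup N(·,−3.86,·) ≈ 0.50`, `inf N(·,−0.09,·) ≈ 0.944`).

Chain: closed form ⇒ `p_L` = grid average of `2log2/β − ξ_k + G(ξ_k)`, `G(z) = (1/β)log((1+cosh β√(z²+D_k))/2)`
(Layer 1 file); per mode `G' = φ = (z/E)tanh(βE/2)` (`cfl_hasDerivAt_bdgG`), `φ` monotone (`cfl_bdgPhi_monotone`),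
so the MVT bracket `(z₂−z₁)φ(z₁) ≤ G(z₂)−G(z₁) ≤ (z₂−z₁)φ(z₂)` (`cfl_bdgG_bracket`) sums to
`(μ₁−μ₂)avg_L n(μ₂) ≤ p_L(μ₁)−p_L(μ₂) ≤ (μ₁−μ₂)avg_L n(μ₁)`, `n = 1 − φ` (`cfl_pressure_increment_bracket`);
`n(θ)` is jointly continuous (removable singularity at `E = 0` via `tanh y = y∫₀¹sech²(ty)dt`), so its grid
average tends to `N` by the 2-D Riemann lemma (`cfl_density_limit`) and the bracket passes to `q₀`
(`cfl_q0_increment_bracket`); finally `(1/25+u)·237/400 ≤ (3/5)/25`, `(1/25−u)·4557/5000 ≥ (9/10)/25`.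
[folklore: BdG mean-field thermodynamics; convexity of the pressure in `μ`]
-/

set_option linter.dupNamespace false

namespace Summit.HubbardSuperconductivity.HubbardSuperconductivity.Theorems.TwSeededEnsembleEquivalenceR.ColdFloorLine

open Matrix Finset Literature.MathematicalPhysics.QuantumLattice Literature.Probability.LatticeModels
open scoped ComplexOrder
open Real MeasureTheory intervalIntegral


/-! ### `tanh` toolkit -/

/-- Half-angle formula `tanh(y/2) = sinh y/(1 + cosh y)`. [folklore] -/
theorem cfl_tanh_half (y : ℝ) : Real.tanh (y / 2) = Real.sinh y / (1 + Real.cosh y) := by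
  have h1 : Real.sinh y = 2 * Real.sinh (y / 2) * Real.cosh (y / 2) := by rw [← Real.sinh_two_mul]; congr 1; ring
  have h2 : 1 + Real.cosh y = 2 * Real.cosh (y / 2) ^ 2 := by
    have h3 := Real.cosh_two_mul (y / 2)
    rw [show 2 * (y / 2) = y by ring] at h3
    rw [h3, Real.cosh_sq (y / 2)]; ring
  rw [h1, h2, Real.tanh_eq_sinh_div_cosh]
  have hc := Real.cosh_pos (y / 2); field_simp

/-- The kernel `(y, t) ↦ sech²(t y)` is jointly continuous. [folklore] -/
theorem cfl_continuous_sech_sq : Continuous fun p : ℝ × ℝ => 1 / Real.cosh (p.2 * p.1) ^ 2 :=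
  continuous_const.div (by fun_prop) fun p => (pow_pos (Real.cosh_pos _) 2).ne'

/-- The `tanh` kernel `T(y) = ∫₀¹ sech²(t y) dt` is continuous. [folklore] -/
theorem cfl_continuous_tanhKernel : Continuous fun y : ℝ => ∫ t in (0 : ℝ)..1, 1 / Real.cosh (t * y) ^ 2 :=
  intervalIntegral.continuous_parametric_intervalIntegral_of_continuous'
    (f := fun y t : ℝ => 1 / Real.cosh (t * y) ^ 2) cfl_continuous_sech_sq 0 1

/-- `y · T(y) = tanh y` for the `tanh` kernel `T(y) = ∫₀¹ sech²(t y) dt` (so `T = tanh y / y`, `T(0) = 1`).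
[folklore] -/
theorem cfl_mul_tanhKernel (y : ℝ) :
    y * ∫ t in (0 : ℝ)..1, 1 / Real.cosh (t * y) ^ 2 = Real.tanh y := by
  rcases eq_or_ne y 0 with rfl | hy
  · simp
  rw [← intervalIntegral.integral_const_mul]
  -- `tanh' = 1/cosh²` (landed elsewhere as `hasDerivAt_real_tanh`; inlined to keep imports minimal)
  have htanh : ∀ x : ℝ, HasDerivAt Real.tanh (1 / Real.cosh x ^ 2) x := fun x => by
    have h := (Real.hasDerivAt_sinh x).div (Real.hasDerivAt_cosh x) (Real.cosh_pos x).ne'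
    have heq : Real.sinh / Real.cosh = Real.tanh := funext fun y => by simp [Real.tanh_eq_sinh_div_cosh]
    have h1 : Real.cosh x * Real.cosh x - Real.sinh x * Real.sinh x = 1 := by nlinarith [Real.cosh_sq x]
    rw [heq, h1] at h
    simpa [one_div] using h
  have hderiv : ∀ t : ℝ, HasDerivAt (fun t : ℝ => Real.tanh (t * y)) (y * (1 / Real.cosh (t * y) ^ 2)) t := by
    intro t
    have h1 : HasDerivAt (fun t : ℝ => t * y) y t := by simpa using (hasDerivAt_id t).mul_const y
    have h2 := (htanh (t * y)).comp t h1
    exact h2.congr_deriv (by ring)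
  have hcont : Continuous fun t : ℝ => y * (1 / Real.cosh (t * y) ^ 2) :=
    continuous_const.mul (continuous_const.div (by fun_prop) fun t => (pow_pos (Real.cosh_pos _) 2).ne')
  rw [intervalIntegral.integral_eq_sub_of_hasDerivAt (fun t _ => hderiv t) (hcont.intervalIntegrable _ _)]
  simp

/-! ### The BdG mode: `G_d(z) = (1/β) log((1 + cosh β√(z² + d))/2)` and its derivative `φ_d(z) = (z/E) tanh(βE/2)` -/

/-- `φ_d` is monotone in `z` (`β > 0`, `d ≥ 0`): on `z ≥ 0` it is the product of the nonnegative nondecreasing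
factors `z/√(z²+d)` and `tanh(β√(z²+d)/2)`; it is odd. [folklore] -/
theorem cfl_bdgPhi_monotone {β d : ℝ} (hβ : 0 < β) (hd : 0 ≤ d) :
    Monotone fun z : ℝ => (if z ^ 2 + d = 0 then (0:ℝ) else z / Real.sqrt (z ^ 2 + d) * Real.tanh (β * Real.sqrt (z ^ 2 + d) / 2)) := by
  -- `tanh` is monotone and nonnegative on `[0,∞)` (landed elsewhere as `tanh_le_tanh`/`tanh_nonneg`; inlined)
  have tanh_le : ∀ {x y : ℝ}, x ≤ y → Real.tanh x ≤ Real.tanh y := fun {x y} h => by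
    rw [Real.tanh_eq_sinh_div_cosh, Real.tanh_eq_sinh_div_cosh,
      div_le_div_iff₀ (Real.cosh_pos x) (Real.cosh_pos y)]
    have h1 : 0 ≤ Real.sinh (y - x) := Real.sinh_nonneg_iff.2 (by linarith)
    rw [Real.sinh_sub] at h1
    linarith
  have tanh_nn : ∀ {x : ℝ}, 0 ≤ x → 0 ≤ Real.tanh x := fun {x} h => by
    rw [Real.tanh_eq_sinh_div_cosh]; exact div_nonneg (Real.sinh_nonneg_iff.2 h) (Real.cosh_pos x).le
  set P : ℝ → ℝ := fun z : ℝ => (if z ^ 2 + d = 0 then (0:ℝ) else z / Real.sqrt (z ^ 2 + d) * Real.tanh (β * Real.sqrt (z ^ 2 + d) / 2)) with hP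
  have hodd : ∀ z, P (-z) = -P z := by
    intro z
    simp only [hP, neg_sq]
    split_ifs <;> ring
  have hnn : ∀ z, 0 ≤ z → 0 ≤ P z := by
    intro z hz
    simp only [hP]
    split_ifs with h
    · exact le_rfl
    · exact mul_nonneg (div_nonneg hz (Real.sqrt_nonneg _)) (tanh_nn (by positivity))
  have hmono : ∀ a b, 0 ≤ a → a ≤ b → P a ≤ P b := by
    intro a b ha hab
    by_cases hA : a ^ 2 + d = 0
    · have : P a = 0 := by simp only [hP, if_pos hA]
      rw [this]
      exact hnn b (ha.trans hab)
    have hB : b ^ 2 + d ≠ 0 := by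
      intro hB; apply hA; nlinarith [sq_nonneg a, mul_self_le_mul_self ha hab]
    simp only [hP, if_neg hA, if_neg hB]
    have hEa : 0 < Real.sqrt (a ^ 2 + d) := Real.sqrt_pos.2 (lt_of_le_of_ne (by positivity) (Ne.symm hA))
    have hEb : 0 < Real.sqrt (b ^ 2 + d) := Real.sqrt_pos.2 (lt_of_le_of_ne (by positivity) (Ne.symm hB))
    have hEab : Real.sqrt (a ^ 2 + d) ≤ Real.sqrt (b ^ 2 + d) := Real.sqrt_le_sqrt (by nlinarith)
    have hb : 0 ≤ b := ha.trans hab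
    apply mul_le_mul
    · rw [div_le_div_iff₀ hEa hEb]
      have h1 : 0 ≤ a * Real.sqrt (b ^ 2 + d) := by positivity
      have h2 : 0 ≤ b * Real.sqrt (a ^ 2 + d) := by positivity
      rw [← pow_le_pow_iff_left₀ h1 h2 two_ne_zero, mul_pow, mul_pow, Real.sq_sqrt (by positivity),
        Real.sq_sqrt (by positivity)]
      nlinarith [mul_le_mul_of_nonneg_right (pow_le_pow_left₀ ha hab 2) hd]
    · exact tanh_le (by nlinarith [mul_le_mul_of_nonneg_left hEab hβ.le])
    · exact tanh_nn (by positivity)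
    · exact div_nonneg hb hEb.le
  intro a b hab
  rcases le_total 0 a with ha | ha
  · exact hmono a b ha hab
  rcases le_total 0 b with hb | hb
  · have h1 : P a ≤ 0 := by have := hnn (-a) (by linarith); rw [hodd] at this; linarith
    exact h1.trans (hnn b hb)
  · have := hmono (-b) (-a) (by linarith) (by linarith)
    rw [hodd, hodd] at this; linarith

/-- `dG_d/dz = φ_d` everywhere (`β > 0`, `d ≥ 0`; for `d = 0`, `G_0(z) = (1/β) log((1 + cosh βz)/2)` and
`φ_0 = tanh(βz/2)`). [folklore] -/
theorem cfl_hasDerivAt_bdgG {β d : ℝ} (hβ : 0 < β) (hd : 0 ≤ d) (z : ℝ) :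
    HasDerivAt (fun z : ℝ => (1 / β * Real.log ((1 + Real.cosh (β * Real.sqrt (z ^ 2 + d))) / 2)))
      (if z ^ 2 + d = 0 then (0:ℝ) else z / Real.sqrt (z ^ 2 + d) * Real.tanh (β * Real.sqrt (z ^ 2 + d) / 2)) z := by
  rcases hd.lt_or_eq with hd' | hd'
  · have hpos : z ^ 2 + d ≠ 0 := by positivity
    rw [if_neg hpos]
    have hE0 : Real.sqrt (z ^ 2 + d) ≠ 0 := Real.sqrt_ne_zero'.2 (by positivity)
    have hE : HasDerivAt (fun z : ℝ => Real.sqrt (z ^ 2 + d)) (2 * z / (2 * Real.sqrt (z ^ 2 + d))) z := by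
      have h1 : HasDerivAt (fun z : ℝ => z ^ 2 + d) (2 * z) z := by
        simpa using (hasDerivAt_pow 2 z).add_const d
      exact h1.sqrt hpos
    have hC : HasDerivAt (fun z : ℝ => (1 + Real.cosh (β * Real.sqrt (z ^ 2 + d))) / 2)
        (Real.sinh (β * Real.sqrt (z ^ 2 + d)) * (β * (2 * z / (2 * Real.sqrt (z ^ 2 + d)))) / 2) z :=
      (((Real.hasDerivAt_cosh _).comp z (hE.const_mul β)).const_add 1).div_const 2
    have hc0 : (1 + Real.cosh (β * Real.sqrt (z ^ 2 + d))) / 2 ≠ 0 := by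
      have := Real.cosh_pos (β * Real.sqrt (z ^ 2 + d)); positivity
    have hc1 : 1 + Real.cosh (β * Real.sqrt (z ^ 2 + d)) ≠ 0 := by
      have := Real.cosh_pos (β * Real.sqrt (z ^ 2 + d)); positivity
    have hL := (hC.log hc0).const_mul (1 / β)
    refine hL.congr_deriv ?_
    rw [cfl_tanh_half]
    field_simp
  · subst hd'
    have hfun : (fun z : ℝ => (1 / β * Real.log ((1 + Real.cosh (β * Real.sqrt (z ^ 2 + 0))) / 2))) =
        fun z => 1 / β * Real.log ((1 + Real.cosh (β * z)) / 2) := by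
      funext z
      rw [add_zero, Real.sqrt_sq_eq_abs, ← Real.cosh_abs (β * z), abs_mul, abs_of_pos hβ]
    rw [hfun]
    have hval : (if z ^ 2 + 0 = 0 then (0:ℝ) else z / Real.sqrt (z ^ 2 + 0) * Real.tanh (β * Real.sqrt (z ^ 2 + 0) / 2)) = Real.tanh (β * z / 2) := by
      simp only [add_zero]
      split_ifs with h
      · have hz : z = 0 := pow_eq_zero_iff two_ne_zero |>.1 h
        simp [hz]
      · rw [Real.sqrt_sq_eq_abs]
        have hz : z ≠ 0 := fun h0 => h (by simp [h0])
        rcases lt_or_gt_of_ne hz with hz' | hz'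
        · rw [abs_of_neg hz', div_neg, div_self hz, show β * -z / 2 = -(β * z / 2) by ring, Real.tanh_neg]
          ring
        · rw [abs_of_pos hz', div_self hz, one_mul]
    rw [hval]
    have hC : HasDerivAt (fun z : ℝ => (1 + Real.cosh (β * z)) / 2) (Real.sinh (β * z) * (β * 1) / 2) z :=
      (((Real.hasDerivAt_cosh _).comp z ((hasDerivAt_id z).const_mul β)).const_add 1).div_const 2
    have hc0 : (1 + Real.cosh (β * z)) / 2 ≠ 0 := by have := Real.cosh_pos (β * z); positivity
    have hc1 : 1 + Real.cosh (β * z) ≠ 0 := by have := Real.cosh_pos (β * z); positivity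
    have hL := (hC.log hc0).const_mul (1 / β)
    refine hL.congr_deriv ?_
    rw [cfl_tanh_half]
    field_simp

/-- **Per-mode convexity bracket**: for `z₁ ≤ z₂`,
`(z₂ − z₁) φ_d(z₁) ≤ G_d(z₂) − G_d(z₁) ≤ (z₂ − z₁) φ_d(z₂)` (mean value theorem + monotonicity of `φ_d`).
[folklore] -/
theorem cfl_bdgG_bracket {β d : ℝ} (hβ : 0 < β) (hd : 0 ≤ d) {z₁ z₂ : ℝ} (h : z₁ ≤ z₂) :
    (z₂ - z₁) * (if z₁ ^ 2 + d = 0 then (0:ℝ) else z₁ / Real.sqrt (z₁ ^ 2 + d) * Real.tanh (β * Real.sqrt (z₁ ^ 2 + d) / 2)) ≤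
        (1 / β * Real.log ((1 + Real.cosh (β * Real.sqrt (z₂ ^ 2 + d))) / 2)) - (1 / β * Real.log ((1 + Real.cosh (β * Real.sqrt (z₁ ^ 2 + d))) / 2)) ∧
      (1 / β * Real.log ((1 + Real.cosh (β * Real.sqrt (z₂ ^ 2 + d))) / 2)) - (1 / β * Real.log ((1 + Real.cosh (β * Real.sqrt (z₁ ^ 2 + d))) / 2)) ≤
        (z₂ - z₁) * (if z₂ ^ 2 + d = 0 then (0:ℝ) else z₂ / Real.sqrt (z₂ ^ 2 + d) * Real.tanh (β * Real.sqrt (z₂ ^ 2 + d) / 2)) := by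
  set P : ℝ → ℝ := fun z : ℝ => (if z ^ 2 + d = 0 then (0:ℝ) else z / Real.sqrt (z ^ 2 + d) * Real.tanh (β * Real.sqrt (z ^ 2 + d) / 2)) with hP
  set G : ℝ → ℝ := fun z : ℝ => (1 / β * Real.log ((1 + Real.cosh (β * Real.sqrt (z ^ 2 + d))) / 2)) with hG
  show (z₂ - z₁) * P z₁ ≤ G z₂ - G z₁ ∧ G z₂ - G z₁ ≤ (z₂ - z₁) * P z₂
  rcases h.lt_or_eq with hlt | heq
  · have hderiv : ∀ x : ℝ, HasDerivAt G (P x) x := fun x => cfl_hasDerivAt_bdgG hβ hd x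
    obtain ⟨c, hc, hslope⟩ := exists_hasDerivAt_eq_slope G P hlt
      (fun x _ => (hderiv x).continuousAt.continuousWithinAt) (fun x _ => hderiv x)
    have hmono := cfl_bdgPhi_monotone hβ hd
    have h1 : P z₁ ≤ P c := hmono hc.1.le
    have h2 : P c ≤ P z₂ := hmono hc.2.le
    have hpos : 0 < z₂ - z₁ := sub_pos.2 hlt
    rw [hslope, le_div_iff₀ hpos] at h1
    rw [hslope, div_le_iff₀ hpos] at h2
    constructor <;> linarith
  · subst heq
    simp

/-! ### The BdG density: kernel representation, continuity, Riemann limit -/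

/-- Kernel representation `φ_d(z) = z (β/2) T(βE/2)`, `T(y) = ∫₀¹ sech²(ty) dt`, `E = √(z²+d)` (`d ≥ 0`):
removes the removable singularity at `E = 0`. [folklore] -/
theorem cfl_bdgPhi_eq_kernel {β d : ℝ} (hβ : 0 < β) (hd : 0 ≤ d) (z : ℝ) :
    (if z ^ 2 + d = 0 then (0:ℝ) else z / Real.sqrt (z ^ 2 + d) * Real.tanh (β * Real.sqrt (z ^ 2 + d) / 2)) =
      z * (β / 2) * ∫ t in (0 : ℝ)..1, 1 / Real.cosh (t * (β * Real.sqrt (z ^ 2 + d) / 2)) ^ 2 := by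
  split_ifs with h
  · have hz2 : z ^ 2 = 0 := by nlinarith [sq_nonneg z]
    have hz : z = 0 := pow_eq_zero_iff two_ne_zero |>.1 hz2
    simp [hz]
  · have hE : 0 < Real.sqrt (z ^ 2 + d) := Real.sqrt_pos.2 (lt_of_le_of_ne (by positivity) (Ne.symm h))
    have key := cfl_mul_tanhKernel (β * Real.sqrt (z ^ 2 + d) / 2)
    rw [← key]
    field_simp

/-- The BdG density `n(θ) = 1 − φ_{D(θ)}(ξ(θ))` is jointly continuous in `θ = (θ₁, θ₂)` (`β > 0`). [folklore] -/
theorem cfl_continuous_bdgDensity (β μ s : ℝ) (hβ : 0 < β) :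
    Continuous (Function.uncurry fun θ₁ θ₂ : ℝ =>
      (1 - (if (-2 * (Real.cos θ₁ + Real.cos θ₂) - μ) ^ 2 + (2 * Real.sqrt 2 * s * (Real.cos θ₁ - Real.cos θ₂)) ^ 2 = 0 then (0:ℝ) else (-2 * (Real.cos θ₁ + Real.cos θ₂) - μ) / Real.sqrt ((-2 * (Real.cos θ₁ + Real.cos θ₂) - μ) ^ 2 + (2 * Real.sqrt 2 * s * (Real.cos θ₁ - Real.cos θ₂)) ^ 2) * Real.tanh (β * Real.sqrt ((-2 * (Real.cos θ₁ + Real.cos θ₂) - μ) ^ 2 + (2 * Real.sqrt 2 * s * (Real.cos θ₁ - Real.cos θ₂)) ^ 2) / 2)))) := by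
  have heq : (Function.uncurry fun θ₁ θ₂ : ℝ =>
      (1 - (if (-2 * (Real.cos θ₁ + Real.cos θ₂) - μ) ^ 2 + (2 * Real.sqrt 2 * s * (Real.cos θ₁ - Real.cos θ₂)) ^ 2 = 0 then (0:ℝ) else (-2 * (Real.cos θ₁ + Real.cos θ₂) - μ) / Real.sqrt ((-2 * (Real.cos θ₁ + Real.cos θ₂) - μ) ^ 2 + (2 * Real.sqrt 2 * s * (Real.cos θ₁ - Real.cos θ₂)) ^ 2) * Real.tanh (β * Real.sqrt ((-2 * (Real.cos θ₁ + Real.cos θ₂) - μ) ^ 2 + (2 * Real.sqrt 2 * s * (Real.cos θ₁ - Real.cos θ₂)) ^ 2) / 2)))) = fun p : ℝ × ℝ =>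
      1 - (-2 * (Real.cos p.1 + Real.cos p.2) - μ) * (β / 2) *
        ∫ t in (0 : ℝ)..1, 1 / Real.cosh (t * (β * Real.sqrt ((-2 * (Real.cos p.1 + Real.cos p.2) - μ) ^ 2 + (2 * Real.sqrt 2 * s * (Real.cos p.1 - Real.cos p.2)) ^ 2) / 2)) ^ 2 := by
    funext p
    show (1 - (if (-2 * (Real.cos p.1 + Real.cos p.2) - μ) ^ 2 + (2 * Real.sqrt 2 * s * (Real.cos p.1 - Real.cos p.2)) ^ 2 = 0 then (0:ℝ) else (-2 * (Real.cos p.1 + Real.cos p.2) - μ) / Real.sqrt ((-2 * (Real.cos p.1 + Real.cos p.2) - μ) ^ 2 + (2 * Real.sqrt 2 * s * (Real.cos p.1 - Real.cos p.2)) ^ 2) * Real.tanh (β * Real.sqrt ((-2 * (Real.cos p.1 + Real.cos p.2) - μ) ^ 2 + (2 * Real.sqrt 2 * s * (Real.cos p.1 - Real.cos p.2)) ^ 2) / 2))) = _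
    rw [cfl_bdgPhi_eq_kernel hβ (sq_nonneg _)]
  rw [heq]
  have hT := cfl_continuous_tanhKernel
  have h1 : Continuous fun p : ℝ × ℝ => (-2 * (Real.cos p.1 + Real.cos p.2) - μ) := by fun_prop
  have h2 : Continuous fun p : ℝ × ℝ => β * Real.sqrt ((-2 * (Real.cos p.1 + Real.cos p.2) - μ) ^ 2 + (2 * Real.sqrt 2 * s * (Real.cos p.1 - Real.cos p.2)) ^ 2) / 2 := by fun_prop
  exact continuous_const.sub ((h1.mul continuous_const).mul (hT.comp h2))

/-- **Riemann limit of the density grid average**: `(1/L²) Σ_k n_k → (1/4π²)∫₀^{2π}∫₀^{2π} n(θ) dθ₂dθ₁`.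
[folklore] -/
theorem cfl_density_limit (β μ s : ℝ) (hβ : 0 < β) :
    ∀ κ : ℝ, 0 < κ → ∃ L₀ : ℕ, ∀ (L : ℕ) [NeZero L], L₀ ≤ L →
      |(∑ k : TorusSite 2 L, (1 - (if (torusBand L k - μ) ^ 2 + (2 * Real.sqrt 2 * s * dWaveGap k) ^ 2 = 0 then (0:ℝ) else (torusBand L k - μ) / Real.sqrt ((torusBand L k - μ) ^ 2 + (2 * Real.sqrt 2 * s * dWaveGap k) ^ 2) * Real.tanh (β * Real.sqrt ((torusBand L k - μ) ^ 2 + (2 * Real.sqrt 2 * s * dWaveGap k) ^ 2) / 2)))) / (L : ℝ) ^ 2 -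
        ((∫ θ₁ in (0 : ℝ)..2 * π, ∫ θ₂ in (0 : ℝ)..2 * π, (1 - (if (-2 * (Real.cos θ₁ + Real.cos θ₂) - μ) ^ 2 + (2 * Real.sqrt 2 * s * (Real.cos θ₁ - Real.cos θ₂)) ^ 2 = 0 then (0:ℝ) else (-2 * (Real.cos θ₁ + Real.cos θ₂) - μ) / Real.sqrt ((-2 * (Real.cos θ₁ + Real.cos θ₂) - μ) ^ 2 + (2 * Real.sqrt 2 * s * (Real.cos θ₁ - Real.cos θ₂)) ^ 2) * Real.tanh (β * Real.sqrt ((-2 * (Real.cos θ₁ + Real.cos θ₂) - μ) ^ 2 + (2 * Real.sqrt 2 * s * (Real.cos θ₁ - Real.cos θ₂)) ^ 2) / 2)))) / (4 * π ^ 2))| ≤ κ := by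
  intro κ hκ
  obtain ⟨L₀, hL₀⟩ := cfl_riemann_sum_torus (cfl_continuous_bdgDensity β μ s hβ) κ hκ
  refine ⟨L₀, fun L _ hL => ?_⟩
  have hsum : (∑ k : TorusSite 2 L, (1 - (if (torusBand L k - μ) ^ 2 + (2 * Real.sqrt 2 * s * dWaveGap k) ^ 2 = 0 then (0:ℝ) else (torusBand L k - μ) / Real.sqrt ((torusBand L k - μ) ^ 2 + (2 * Real.sqrt 2 * s * dWaveGap k) ^ 2) * Real.tanh (β * Real.sqrt ((torusBand L k - μ) ^ 2 + (2 * Real.sqrt 2 * s * dWaveGap k) ^ 2) / 2)))) =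
      ∑ k : Fin 2 → ZMod L, (fun θ₁ θ₂ : ℝ =>
        (1 - (if (-2 * (Real.cos θ₁ + Real.cos θ₂) - μ) ^ 2 + (2 * Real.sqrt 2 * s * (Real.cos θ₁ - Real.cos θ₂)) ^ 2 = 0 then (0:ℝ) else (-2 * (Real.cos θ₁ + Real.cos θ₂) - μ) / Real.sqrt ((-2 * (Real.cos θ₁ + Real.cos θ₂) - μ) ^ 2 + (2 * Real.sqrt 2 * s * (Real.cos θ₁ - Real.cos θ₂)) ^ 2) * Real.tanh (β * Real.sqrt ((-2 * (Real.cos θ₁ + Real.cos θ₂) - μ) ^ 2 + (2 * Real.sqrt 2 * s * (Real.cos θ₁ - Real.cos θ₂)) ^ 2) / 2))))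
        (2 * π * ((k 0).val : ℝ) / L) (2 * π * ((k 1).val : ℝ) / L) := by
    refine Finset.sum_congr rfl fun k _ => ?_
    simp only [torusBand, dWaveGap, latticeMomentum, Fin.sum_univ_two]
  rw [hsum]
  exact hL₀ L hL

/-! ### Finite-volume increment bracket and its limit -/

/-- **Finite-volume increment bracket** (`L ≥ 3`, `β > 0`, `μ₂ ≤ μ₁`):
`(μ₁−μ₂)·(1/L²)Σ_k n_k(μ₂) ≤ p_L(μ₁) − p_L(μ₂) ≤ (μ₁−μ₂)·(1/L²)Σ_k n_k(μ₁)` — the pressure is the grid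
average of `2log2/β − ξ_k + G(ξ_k)` and each mode obeys the convexity bracket. [folklore] -/
theorem cfl_pressure_increment_bracket {L : ℕ} [NeZero L] (hL : 3 ≤ L) {β : ℝ} (hβ : 0 < β) (s : ℝ)
    {μ₁ μ₂ : ℝ} (hμ : μ₂ ≤ μ₁) :
    (μ₁ - μ₂) * (∑ k : TorusSite 2 L, (1 - (if (torusBand L k - μ₂) ^ 2 + (2 * Real.sqrt 2 * s * dWaveGap k) ^ 2 = 0 then (0:ℝ) else (torusBand L k - μ₂) / Real.sqrt ((torusBand L k - μ₂) ^ 2 + (2 * Real.sqrt 2 * s * dWaveGap k) ^ 2) * Real.tanh (β * Real.sqrt ((torusBand L k - μ₂) ^ 2 + (2 * Real.sqrt 2 * s * dWaveGap k) ^ 2) / 2)))) / (L : ℝ) ^ 2 ≤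
        Real.log (Matrix.partitionFn β (dWaveSourceTorus L 0 μ₁ s)).re / (β * (L : ℝ) ^ 2) -
          Real.log (Matrix.partitionFn β (dWaveSourceTorus L 0 μ₂ s)).re / (β * (L : ℝ) ^ 2) ∧
      Real.log (Matrix.partitionFn β (dWaveSourceTorus L 0 μ₁ s)).re / (β * (L : ℝ) ^ 2) -
          Real.log (Matrix.partitionFn β (dWaveSourceTorus L 0 μ₂ s)).re / (β * (L : ℝ) ^ 2) ≤
        (μ₁ - μ₂) * (∑ k : TorusSite 2 L, (1 - (if (torusBand L k - μ₁) ^ 2 + (2 * Real.sqrt 2 * s * dWaveGap k) ^ 2 = 0 then (0:ℝ) else (torusBand L k - μ₁) / Real.sqrt ((torusBand L k - μ₁) ^ 2 + (2 * Real.sqrt 2 * s * dWaveGap k) ^ 2) * Real.tanh (β * Real.sqrt ((torusBand L k - μ₁) ^ 2 + (2 * Real.sqrt 2 * s * dWaveGap k) ^ 2) / 2)))) / (L : ℝ) ^ 2 := by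
  rw [cfl_freeSourcedPressure_eq_gridAverage hL hβ.ne' μ₁ s, cfl_freeSourcedPressure_eq_gridAverage hL hβ.ne' μ₂ s,
    ← sub_div, ← Finset.sum_sub_distrib, Finset.mul_sum, Finset.mul_sum]
  have hL0 : (0 : ℝ) < (L : ℝ) ^ 2 := by
    have : (0 : ℝ) < L := by exact_mod_cast Nat.pos_of_ne_zero (NeZero.ne L)
    positivity
  constructor
  · apply div_le_div_of_nonneg_right _ hL0.le
    refine Finset.sum_le_sum fun k _ => ?_
    have hb := (cfl_bdgG_bracket hβ (sq_nonneg (2 * Real.sqrt 2 * s * dWaveGap k))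
      (show torusBand L k - μ₁ ≤ torusBand L k - μ₂ by linarith)).2
    have e : torusBand L k - μ₂ - (torusBand L k - μ₁) = μ₁ - μ₂ := by ring
    rw [e] at hb
    rw [mul_sub, mul_one]
    linarith
  · apply div_le_div_of_nonneg_right _ hL0.le
    refine Finset.sum_le_sum fun k _ => ?_
    have hb := (cfl_bdgG_bracket hβ (sq_nonneg (2 * Real.sqrt 2 * s * dWaveGap k))
      (show torusBand L k - μ₁ ≤ torusBand L k - μ₂ by linarith)).1
    have e : torusBand L k - μ₂ - (torusBand L k - μ₁) = μ₁ - μ₂ := by ring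
    rw [e] at hb
    rw [mul_sub, mul_one]
    linarith

/-- **Limit increment bracket**: if `p_L(β,μ,s) → q₀(μ)` for `μ ∈ [−4,0]`, then for `−4 ≤ μ₂ ≤ μ₁ ≤ 0`
`(μ₁−μ₂)·N(β,μ₂,s) ≤ q₀(μ₁) − q₀(μ₂) ≤ (μ₁−μ₂)·N(β,μ₁,s)` with `N` the Brillouin-zone average of the BdG
density. [folklore] -/
theorem cfl_q0_increment_bracket (β s : ℝ) (hβ : 0 < β) (q₀ : ℝ → ℝ)
    (hq : ∀ μ ∈ Set.Icc (-4 : ℝ) 0, ∀ κ : ℝ, 0 < κ → ∃ L₀ : ℕ, ∀ (L : ℕ) [NeZero L], L₀ ≤ L →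
      |Real.log (Matrix.partitionFn β (dWaveSourceTorus L 0 μ s)).re / (β * (L : ℝ) ^ 2) - q₀ μ| ≤ κ)
    {μ₁ μ₂ : ℝ} (h₁ : μ₁ ∈ Set.Icc (-4 : ℝ) 0) (h₂ : μ₂ ∈ Set.Icc (-4 : ℝ) 0) (hμ : μ₂ ≤ μ₁) :
    (μ₁ - μ₂) * ((∫ θ₁ in (0 : ℝ)..2 * π, ∫ θ₂ in (0 : ℝ)..2 * π, (1 - (if (-2 * (Real.cos θ₁ + Real.cos θ₂) - μ₂) ^ 2 + (2 * Real.sqrt 2 * s * (Real.cos θ₁ - Real.cos θ₂)) ^ 2 = 0 then (0:ℝ) else (-2 * (Real.cos θ₁ + Real.cos θ₂) - μ₂) / Real.sqrt ((-2 * (Real.cos θ₁ + Real.cos θ₂) - μ₂) ^ 2 + (2 * Real.sqrt 2 * s * (Real.cos θ₁ - Real.cos θ₂)) ^ 2) * Real.tanh (β * Real.sqrt ((-2 * (Real.cos θ₁ + Real.cos θ₂) - μ₂) ^ 2 + (2 * Real.sqrt 2 * s * (Real.cos θ₁ - Real.cos θ₂)) ^ 2) / 2)))) / (4 * π ^ 2))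 ≤ q₀ μ₁ - q₀ μ₂ ∧
      q₀ μ₁ - q₀ μ₂ ≤ (μ₁ - μ₂) * ((∫ θ₁ in (0 : ℝ)..2 * π, ∫ θ₂ in (0 : ℝ)..2 * π, (1 - (if (-2 * (Real.cos θ₁ + Real.cos θ₂) - μ₁) ^ 2 + (2 * Real.sqrt 2 * s * (Real.cos θ₁ - Real.cos θ₂)) ^ 2 = 0 then (0:ℝ) else (-2 * (Real.cos θ₁ + Real.cos θ₂) - μ₁) / Real.sqrt ((-2 * (Real.cos θ₁ + Real.cos θ₂) - μ₁) ^ 2 + (2 * Real.sqrt 2 * s * (Real.cos θ₁ - Real.cos θ₂)) ^ 2) * Real.tanh (β * Real.sqrt ((-2 * (Real.cos θ₁ + Real.cos θ₂) - μ₁) ^ 2 + (2 * Real.sqrt 2 * s * (Real.cos θ₁ - Real.cos θ₂)) ^ 2) / 2)))) / (4 * π ^ 2)) := by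
  have hδ : 0 ≤ μ₁ - μ₂ := sub_nonneg.2 hμ
  constructor
  · apply le_of_forall_pos_le_add
    intro η hη
    obtain ⟨L₁, hL₁⟩ := hq μ₁ h₁ (η / 4) (by positivity)
    obtain ⟨L₂, hL₂⟩ := hq μ₂ h₂ (η / 4) (by positivity)
    obtain ⟨L₃, hL₃⟩ := cfl_density_limit β μ₂ s hβ (η / (2 * (μ₁ - μ₂) + 2)) (by positivity)
    set L : ℕ := max (max L₁ L₂) (max L₃ 3) with hLdef
    have hL3 : 3 ≤ L := le_max_of_le_right (le_max_right _ _)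
    haveI : NeZero L := ⟨by omega⟩
    have a1 := hL₁ L (le_max_of_le_left (le_max_left _ _))
    have a2 := hL₂ L (le_max_of_le_left (le_max_right _ _))
    have a3 := hL₃ L (le_max_of_le_right (le_max_left _ _))
    have hfin := (cfl_pressure_increment_bracket hL3 hβ s hμ).1
    rw [abs_le] at a1 a2 a3
    rw [mul_div_assoc] at hfin
    have e1 : (μ₁ - μ₂) * ((∫ θ₁ in (0 : ℝ)..2 * π, ∫ θ₂ in (0 : ℝ)..2 * π, (1 - (if (-2 * (Real.cos θ₁ + Real.cos θ₂) - μ₂) ^ 2 + (2 * Real.sqrt 2 * s * (Real.cos θ₁ - Real.cos θ₂)) ^ 2 = 0 then (0:ℝ) else (-2 * (Real.cos θ₁ + Real.cos θ₂) - μ₂) / Real.sqrt ((-2 * (Real.cos θ₁ + Real.cos θ₂) - μ₂) ^ 2 + (2 * Real.sqrt 2 * s * (Real.cos θ₁ - Real.cos θ₂)) ^ 2) * Real.tanh (β * Real.sqrt ((-2 * (Real.cos θ₁ + Real.cos θ₂) - μ₂) ^ 2 + (2 * Real.sqrt 2 * s * (Real.cos θ₁ - Real.cos θ₂)) ^ 2)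 / 2)))) / (4 * π ^ 2)) ≤
        (μ₁ - μ₂) * ((∑ k : TorusSite 2 L, (1 - (if (torusBand L k - μ₂) ^ 2 + (2 * Real.sqrt 2 * s * dWaveGap k) ^ 2 = 0 then (0:ℝ) else (torusBand L k - μ₂) / Real.sqrt ((torusBand L k - μ₂) ^ 2 + (2 * Real.sqrt 2 * s * dWaveGap k) ^ 2) * Real.tanh (β * Real.sqrt ((torusBand L k - μ₂) ^ 2 + (2 * Real.sqrt 2 * s * dWaveGap k) ^ 2) / 2)))) / (L : ℝ) ^ 2) + (μ₁ - μ₂) * (η / (2 * (μ₁ - μ₂) + 2)) := by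
      rw [← mul_add]
      exact mul_le_mul_of_nonneg_left (by linarith [a3.1]) hδ
    have e2 : (μ₁ - μ₂) * (η / (2 * (μ₁ - μ₂) + 2)) ≤ η / 2 := by
      rw [mul_div_assoc', div_le_iff₀ (by positivity)]
      nlinarith
    linarith [a1.2, a2.1]
  · apply le_of_forall_pos_le_add
    intro η hη
    obtain ⟨L₁, hL₁⟩ := hq μ₁ h₁ (η / 4) (by positivity)
    obtain ⟨L₂, hL₂⟩ := hq μ₂ h₂ (η / 4) (by positivity)
    obtain ⟨L₃, hL₃⟩ := cfl_density_limit β μ₁ s hβ (η / (2 * (μ₁ - μ₂) + 2)) (by positivity)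
    set L : ℕ := max (max L₁ L₂) (max L₃ 3) with hLdef
    have hL3 : 3 ≤ L := le_max_of_le_right (le_max_right _ _)
    haveI : NeZero L := ⟨by omega⟩
    have a1 := hL₁ L (le_max_of_le_left (le_max_left _ _))
    have a2 := hL₂ L (le_max_of_le_left (le_max_right _ _))
    have a3 := hL₃ L (le_max_of_le_right (le_max_left _ _))
    have hfin := (cfl_pressure_increment_bracket hL3 hβ s hμ).2
    rw [abs_le] at a1 a2 a3
    rw [mul_div_assoc] at hfin
    have e1 : (μ₁ - μ₂) * ((∑ k : TorusSite 2 L, (1 - (if (torusBand L k - μ₁) ^ 2 + (2 * Real.sqrt 2 * s * dWaveGap k) ^ 2 = 0 then (0:ℝ) else (torusBand L k - μ₁) / Real.sqrt ((torusBand L k - μ₁) ^ 2 + (2 * Real.sqrt 2 * s * dWaveGap k) ^ 2) * Real.tanh (β * Real.sqrt ((torusBand L k - μ₁) ^ 2 + (2 * Real.sqrt 2 * s * dWaveGap k) ^ 2) / 2)))) / (L : ℝ) ^ 2) ≤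
        (μ₁ - μ₂) * ((∫ θ₁ in (0 : ℝ)..2 * π, ∫ θ₂ in (0 : ℝ)..2 * π, (1 - (if (-2 * (Real.cos θ₁ + Real.cos θ₂) - μ₁) ^ 2 + (2 * Real.sqrt 2 * s * (Real.cos θ₁ - Real.cos θ₂)) ^ 2 = 0 then (0:ℝ) else (-2 * (Real.cos θ₁ + Real.cos θ₂) - μ₁) / Real.sqrt ((-2 * (Real.cos θ₁ + Real.cos θ₂) - μ₁) ^ 2 + (2 * Real.sqrt 2 * s * (Real.cos θ₁ - Real.cos θ₂)) ^ 2) * Real.tanh (β * Real.sqrt ((-2 * (Real.cos θ₁ + Real.cos θ₂) - μ₁) ^ 2 + (2 * Real.sqrt 2 * s * (Real.cos θ₁ - Real.cos θ₂)) ^ 2) / 2)))) / (4 * π ^ 2)) + (μ₁ - μ₂) * (η / (2 * (μ₁ - μ₂) + 2)) := by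
      rw [← mul_add]
      exact mul_le_mul_of_nonneg_left (by linarith [a3.2]) hδ
    have e2 : (μ₁ - μ₂) * (η / (2 * (μ₁ - μ₂) + 2)) ≤ η / 2 := by
      rw [mul_div_assoc', div_le_iff₀ (by positivity)]
      nlinarith
    linarith [a1.1, a2.2]

/-! ### S4b from the two certified density bounds -/

/-- **Reduction of `stub_freeColdEdgeIncrements` (S4b) to two Brillouin-zone density bounds** (registered helper
stub `cfl_freeColdEdgeIncrements_of_densityBounds`). If, uniformly in `β ≥ 20` and `|h| ≤ 3`, the zone average
`N(β,μ,h) = (1/4π²)∫∫ [1 − (ξ/E) tanh(βE/2)]` of the free BdG density satisfies `N(β,−3.86,h) ≤ 0.5925` and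
`N(β,−0.09,h) ≥ 0.9114`, then the two cold edge increments of the free sourced limit pressure hold:
`q₀(−3.86) − q₀(−3.9−u) ≤ (0.04+u)·0.5925 ≤ 0.024` and `q₀(−0.05−u) − q₀(−0.09) ≥ (0.04−u)·0.9114 ≥ 0.036`
(`0 ≤ u ≤ 1/2000`). [folklore composition] -/
theorem cfl_freeColdEdgeIncrements_of_densityBounds : (∀ (β h : ℝ), 20 ≤ β → |h| ≤ 3 → ((∫ θ₁ in (0 : ℝ)..2 * π, ∫ θ₂ in (0 : ℝ)..2 * π, (1 - (if (-2 * (Real.cos θ₁ + Real.cos θ₂) - (-(193 / 50) : ℝ)) ^ 2 + (2 * Real.sqrt 2 * h * (Real.cos θ₁ - Real.cos θ₂)) ^ 2 = 0 then (0:ℝ) else (-2 * (Real.cos θ₁ + Real.cos θ₂) - (-(193 / 50) : ℝ)) / Real.sqrt ((-2 * (Real.cos θ₁ + Real.cos θ₂) - (-(193 / 50) : ℝ)) ^ 2 + (2 * Real.sqrt 2 * h * (Real.cos θ₁ - Real.cos θ₂)) ^ 2) * Real.tanh (β * Real.sqrt ((-2 * (Real.cos θ₁ + Real.cos θ₂)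 - (-(193 / 50) : ℝ)) ^ 2 + (2 * Real.sqrt 2 * h * (Real.cos θ₁ - Real.cos θ₂)) ^ 2) / 2)))) / (4 * π ^ 2)) ≤ 237 / 400) → (∀ (β h : ℝ), 20 ≤ β → |h| ≤ 3 → (4557 / 5000 : ℝ) ≤ ((∫ θ₁ in (0 : ℝ)..2 * π, ∫ θ₂ in (0 : ℝ)..2 * π, (1 - (if (-2 * (Real.cos θ₁ + Real.cos θ₂) - (-(9 / 100) : ℝ)) ^ 2 + (2 * Real.sqrt 2 * h * (Real.cos θ₁ - Real.cos θ₂)) ^ 2 = 0 then (0:ℝ) else (-2 * (Real.cos θ₁ + Real.cos θ₂) - (-(9 / 100) : ℝ)) / Real.sqrt ((-2 * (Real.cos θ₁ + Real.cos θ₂) - (-(9 / 100) : ℝ)) ^ 2 + (2 * Real.sqrt 2 * h * (Real.cos θ₁ - Real.cos θ₂)) ^ 2) * Real.tanh (β * Real.sqrt ((-2 * (Real.cos θ₁ + Real.cos θ₂) - (-(9 / 100) : ℝ)) ^ 2 + (2 * Real.sqrt 2 * h * (Real.cos θ₁ - Real.cos θ₂)) ^ 2) / 2)))) / (4 * π ^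 2))) → ∀ (β u h : ℝ), 20 ≤ β → 0 ≤ u → u ≤ 1 / 2000 → |h| ≤ 3 → ∀ q₀ : ℝ → ℝ, (∀ μ ∈ Set.Icc (-4 : ℝ) 0, ∀ κ : ℝ, 0 < κ → ∃ L₀ : ℕ, ∀ (L : ℕ) [NeZero L], L₀ ≤ L → |Real.log (Matrix.partitionFn β (dWaveSourceTorus L 0 μ h)).re / (β * (L : ℝ) ^ 2) - q₀ μ| ≤ κ) → q₀ (-(39 / 10) + 1 / 25) - q₀ (-(39 / 10) - u) ≤ 3 / 5 * (1 / 25) ∧ 9 / 10 * (1 / 25) ≤ q₀ (-(1 / 20) - u) - q₀ (-(1 / 20) - 1 / 25) := by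
  intro hC1 hC2 β u h hβ hu0 hu1 hh q₀ hq
  have hβ0 : 0 < β := by linarith
  constructor
  · have hD := (cfl_q0_increment_bracket β h hβ0 q₀ hq (μ₁ := -(39 / 10) + 1 / 25) (μ₂ := -(39 / 10) - u)
      ⟨by norm_num, by norm_num⟩ ⟨by linarith, by linarith⟩ (by linarith)).2
    have e : (-(39 / 10) + 1 / 25 : ℝ) = (-(193 / 50) : ℝ) := by norm_num
    rw [e] at hD
    have hN := hC1 β h hβ hh
    have e2 : (-(193 / 50) : ℝ) - (-(39 / 10) - u) = 1 / 25 + u := by ring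
    rw [e2] at hD
    nlinarith [mul_nonneg hu0 (sub_nonneg.2 hN)]
  · have hD := (cfl_q0_increment_bracket β h hβ0 q₀ hq (μ₁ := -(1 / 20) - u) (μ₂ := -(1 / 20) - 1 / 25)
      ⟨by linarith, by linarith⟩ ⟨by norm_num, by norm_num⟩ (by linarith)).1
    have e : (-(1 / 20) - 1 / 25 : ℝ) = (-(9 / 100) : ℝ) := by norm_num
    rw [e] at hD
    have hN := hC2 β h hβ hh
    have e2 : (-(1 / 20) - u - (-(9 / 100) : ℝ)) = 1 / 25 - u := by ring
    rw [e2] at hD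
    nlinarith [mul_nonneg (show (0:ℝ) ≤ 1 / 25 - u by linarith) (sub_nonneg.2 hN), mul_nonneg hu0 (sub_nonneg.2 hN)]

end Summit.HubbardSuperconductivity.HubbardSuperconductivity.Theorems.TwSeededEnsembleEquivalenceR.ColdFloorLine
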